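import Literature.Topology.FourManifolds.CappellShanesonTraceClassesProofs
import Literature.Topology.FourManifolds.CappellShanesonIdealClasses
import Literature.Topology.FourManifolds.CappellShanesonGompfConjectureSmallTraces
import HarnessLib

/-!
# The class group of the trace `14` field (discriminant `16609 = 17 · 977`) and Gompf's conjecture
# for the traces `14` and `-9` (Kim–Yamada 2023, Theorem B)

Serves the named fact
`Literature.Topology.FourManifolds.kimYamada2023_nonempty_diffeomorph_sphere_four_of_trace_mem_Icc`
(`CappellShaneson.lean`; M. H. Kim, S. Yamada, *Ideal classes and Cappell–Shaneson homotopy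
4-spheres*, Kyungpook Math. J. 63 (2023) 373–411 = arXiv:1707.03860, Cor. C), reduced in the tree
to Gompf's three topological leaves and Theorem B in matrix form (`GompfConjectureForTrace n`) for
the traces not yet proved (`[-7, 12]` are: `CappellShanesonClassGroupTwelve.lean`). This file PROVES
Theorem B for the trace `14` and, by Theorem A, for `-9 = 5 - 14`, in the same way as the trace
`12` (sibling file): the row `n = 14` of Kim–Yamada's Table 2 — `C(ℤ[Θ₁₄])` is covered by the
representatives `(1, 1, 14)` and `(5, 7, 14)` — is proved as a class-group computation, and the
non-trivial class moves by one Gompf move to the trace `7 = 14 - 7` (Lemma 6.1 / §6.1: "every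
non-trivial element of `C(ℤ[Θₙ])` has minimal representative `(c, d, n)` such that `n ≡ n₀` for
some `6 - n ≤ n₀ ≤ n - 1`"), where Gompf's conjecture holds (class number one).

## The number theory

For a cubic number field `K` generated by a root `θ` of `f₁₄ = x³ - 14x² + 13x - 1`:

* `Δ(f₁₄) = 14·12·11·9 - 23 = 16609 = 17 · 977` is squarefree, so `𝓞 K = ℤ[θ]`, `d_K = 16609` and
  `⌊M_K⌋ ≤ 36` (`floor_minkowskiBound_le_cubic`);
* Dedekind–Kummer at `p ≤ 36` (Marcus, Ch. 3, Thm. 27): `2, 3, 5` are inert; unique roots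
  `5, 7, 11, 12, 28, 27` modulo `7, 11, 13, 19, 29, 31` give the degree-one primes `𝔭₇ = (7, θ - 5)`,
  `𝔭₁₁ = (11, θ - 7)`, `𝔭₁₃ = (13, θ - 11)`, `𝔭₁₉ = (19, θ - 12)`, `𝔭₂₉ = (29, θ - 28)`,
  `𝔭₃₁ = (31, θ - 27)`; `f₁₄ ≡ (x - 9)(x - 11)² (mod 17)` (`17 ∣ Δ` ramifies) gives `(17, θ - 9)`,
  `(17, θ - 11)`, and `f₁₄ ≡ (x - 2)(x - 5)(x - 7) (mod 23)` gives the three primes above `23` —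
  via the general lemma `eq_span_pair_of_split_of_sq` (primes above `p` when `f_a` is a product of
  linear factors mod `p`, distinct or not);
* relations with explicit cofactors: `𝔭₇² = (3θ - 1)` (norm `49`), `𝔭₇ 𝔭₁₁ = (2θ - 3)` (`77`),
  `𝔭₇ 𝔭₁₃ = (θ + 2)` (`91`), `(17, θ - 9) = (2θ - 1)` (`17`), `𝔭₁₃ (17, θ - 11) = (θ - 11)` (`221`),
  `𝔭₇ 𝔭₁₉ = (θ - 12)` (`133`), `(23, θ - 2) = (θ - 2)` (`23`), `𝔭₇ (23, θ - 5) = (θ - 5)` (`161`),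
  `𝔭₇ (23, θ - 7) = (θ² - 4θ + 2)` (`161`), `𝔭₂₉ = (θ + 1)` (`29`), `𝔭₇ 𝔭₃₁ = (2θ² - 1)` (`217`);
* hence every ideal class is `1` or `[𝔭₇]`, `[𝔭₇]² = 1` (`classGroup_mem_pair_fourteen`).

Transport to `ℤ[X]/(f₁₄)` and Prop. 2.14 (`exists_isConj_standardCSMatrix_of_cover`,
`CappellShanesonIdealClasses.lean`): every Cappell–Shaneson matrix of trace `14` is similar to
`X_{1,1,14} = A₁₂` or to `X_{5,7,14}` (`isConj_standardCSMatrix_of_trace_eq_fourteen`), and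
`X_{5,7,14} ∼_G X_{5,7,7} ∼ A₀`: `gompfConjectureForTrace_fourteen`, `gompfConjectureForTrace_neg_nine`.
No named fact is introduced (D-0026).

## References

* [KimYamada2023] M. H. Kim, S. Yamada, Kyungpook Math. J. 63 (2023) 373–411 (arXiv:1707.03860):
  §2.3 (Prop. 2.14), §5 (Table 2), §6.1 (Lemma 6.1 and the proof of Thm. B), Thm. A.
* [Marcus2018] D. A. Marcus, *Number Fields*, 2nd ed., Ch. 3, Thm. 27 (Dedekind–Kummer); Ch. 5,
  Cor. 2 of Thm. 37 (Minkowski bound).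
-/

noncomputable section

open Set Polynomial Module NumberField Ideal
open scoped NumberField MatrixGroups nonZeroDivisors
open Literature.LinearAlgebra.Matrix

namespace Literature.Topology.FourManifolds

/-! ### Dedekind–Kummer at a prime where `f_a` splits into linear factors -/

section Split

variable {K : Type*} [Field K] [NumberField K] {a : ℤ} {θ : K}

/-- A monic irreducible factor of a product of three monic linear polynomials over `𝔽_p` is one of
them. [folklore] -/
theorem eq_of_irreducible_of_dvd_linear_mul {p : ℕ} [Fact p.Prime] {Qb : (ZMod p)[X]}
    (hirr : Irreducible Qb) (hmon : Qb.Monic) {c₁ c₂ c₃ : ZMod p}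
    (hdvd : Qb ∣ (X - C c₁) * (X - C c₂) * (X - C c₃)) :
    Qb = X - C c₁ ∨ Qb = X - C c₂ ∨ Qb = X - C c₃ := by
  have hprime : Prime Qb := hirr.prime
  have hdeg1 : 1 ≤ Qb.natDegree := by
    rcases Nat.eq_zero_or_pos Qb.natDegree with h0 | h0
    · exact absurd (Polynomial.eq_one_of_monic_natDegree_zero hmon h0 ▸ isUnit_one) hirr.not_isUnit
    · exact h0
  have key : ∀ c : ZMod p, Qb ∣ X - C c → Qb = X - C c := fun c hc =>
    (Polynomial.eq_of_monic_of_dvd_of_natDegree_le hmon (monic_X_sub_C c) hc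
      (by rw [natDegree_X_sub_C]; exact hdeg1)).symm
  rcases hprime.dvd_or_dvd hdvd with h12 | h3
  · rcases hprime.dvd_or_dvd h12 with h1 | h2
    · exact Or.inl (key _ h1)
    · exact Or.inr (Or.inl (key _ h2))
  · exact Or.inr (Or.inr (key _ h3))

/-- **Primes above a prime `p` at which `f_a` is a product of linear factors modulo `p`**
(`𝓞 K = ℤ[θ]` by the square-factor hypothesis; Dedekind–Kummer): if
`f_a ≡ (x - c₁)(x - c₂)(x - c₃) (mod p)` (the `cᵢ` need not be distinct: `p` may ramify), every
prime above `p` is one of `(p, θ - cᵢ)`. [cite: Marcus2018, Ch. 3, Thm. 27] -/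
theorem eq_span_pair_of_split_of_sq (hθ : aeval θ (csPoly a) = 0) (h3 : finrank ℚ K = 3)
    (hsq : ∀ r e : ℤ, csDisc a = r ^ 2 * e → 2 < |e| → IsUnit r) {p : ℕ} (hp : p.Prime)
    {c₁ c₂ c₃ : ℤ}
    (hfac : csPolyMod a p = (X - C (c₁ : ZMod p)) * (X - C (c₂ : ZMod p)) * (X - C (c₃ : ZMod p)))
    {P : Ideal (𝓞 K)} (hP : P ∈ primesOver (span {(p : ℤ)}) (𝓞 K)) :
    P = span {(p : 𝓞 K), thetaInt hθ - (c₁ : 𝓞 K)} ∨ P = span {(p : 𝓞 K), thetaInt hθ - (c₂ : 𝓞 K)} ∨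
      P = span {(p : 𝓞 K), thetaInt hθ - (c₃ : 𝓞 K)} := by
  haveI := Fact.mk hp
  obtain ⟨Qb, hirr, hmon, hdvd, -, hspan⟩ := exists_factor_of_mem_primesOver_of_sq hθ h3 hsq hp hP
  rw [hfac] at hdvd
  have hlin : ∀ c : ℤ, Qb = X - C (c : ZMod p) → P = span {(p : 𝓞 K), thetaInt hθ - (c : 𝓞 K)} := by
    intro c hc
    have hQb' : (X - C c : ℤ[X]).map (Int.castRingHom (ZMod p)) = Qb := by
      rw [Polynomial.map_sub, map_X, map_C, eq_intCast, hc]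
    have hPeq := hspan (X - C c) hQb'
    simp only [map_sub, aeval_X, aeval_C, algebraMap_int_eq, Int.coe_castRingHom] at hPeq
    exact hPeq
  rcases eq_of_irreducible_of_dvd_linear_mul hirr hmon hdvd with h1 | h2 | h3'
  · exact Or.inl (hlin _ h1)
  · exact Or.inr (Or.inl (hlin _ h2))
  · exact Or.inr (Or.inr (hlin _ h3'))

end Split

section Field

variable {K : Type*} [Field K] [NumberField K] {θ : K}

/-! ### Discriminant `16609` and `𝓞 K = ℤ[θ]` -/

/-- `Δ(f₁₄) = 14·12·11·9 - 23 = 16609`. [cite: KimYamada2023, §3 (Δ(fₙ) = n(n-2)(n-3)(n-5) - 23)] -/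
theorem csDisc_fourteen : csDisc 14 = 16609 := by
  decide

set_option maxRecDepth 4096 in
/-- `16609 = 17 · 977` is squarefree, so `Δ(f₁₄)` has no factorisation `r² e` with `|e| > 2`,
`r ≠ ±1`, and `𝓞 K = ℤ[θ]`. [folklore] -/
theorem csDisc_fourteen_sq : ∀ r e : ℤ, csDisc 14 = r ^ 2 * e → 2 < |e| → IsUnit r :=
  isUnit_of_eq_sq_mul (B := 128) (by decide) (by decide) (by decide)

/-- `d_K = 16609` for the trace `14` field. [folklore] -/
theorem discr_eq_fourteen (hθ : aeval θ (csPoly 14) = 0) (h3 : finrank ℚ K = 3) :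
    NumberField.discr K = 16609 := by
  rw [discr_eq_csDisc_of_sq hθ h3 csDisc_fourteen_sq, csDisc_fourteen]

/-- The cubic relation `θ³ - 14θ² + 13θ - 1 = 0` in `𝓞 K`. [folklore] -/
theorem thetaInt_rel_fourteen (hθ : aeval θ (csPoly 14) = 0) :
    (thetaInt hθ) ^ 3 - 14 * (thetaInt hθ) ^ 2 + 13 * thetaInt hθ - 1 = 0 := by
  have rel := thetaInt_rel hθ
  push_cast at rel
  linear_combination rel

/-! ### The primes of norm at most `36` (Dedekind–Kummer) -/

/-- `2` is inert (`f₁₄ ≡ x³ + x + 1 (mod 2)`). [folklore] -/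
theorem eq_span_two_fourteen (hθ : aeval θ (csPoly 14) = 0) (h3 : finrank ℚ K = 3)
    {P : Ideal (𝓞 K)} (hP : P ∈ primesOver (span {((2 : ℕ) : ℤ)}) (𝓞 K)) :
    P = span {((2 : ℕ) : 𝓞 K)} :=
  eq_span_of_no_root_of_sq hθ h3 csDisc_fourteen_sq Nat.prime_two hP (by decide)

/-- `3` is inert. [folklore] -/
theorem eq_span_three_fourteen (hθ : aeval θ (csPoly 14) = 0) (h3 : finrank ℚ K = 3)
    {P : Ideal (𝓞 K)} (hP : P ∈ primesOver (span {((3 : ℕ) : ℤ)}) (𝓞 K)) :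
    P = span {((3 : ℕ) : 𝓞 K)} :=
  eq_span_of_no_root_of_sq hθ h3 csDisc_fourteen_sq Nat.prime_three hP (by decide)

/-- `5` is inert. [folklore] -/
theorem eq_span_five_fourteen (hθ : aeval θ (csPoly 14) = 0) (h3 : finrank ℚ K = 3)
    {P : Ideal (𝓞 K)} (hP : P ∈ primesOver (span {((5 : ℕ) : ℤ)}) (𝓞 K)) :
    P = span {((5 : ℕ) : 𝓞 K)} :=
  eq_span_of_no_root_of_sq hθ h3 csDisc_fourteen_sq (by norm_num) hP (by decide)

/-- `𝔭₇ = (7, θ - 5)` (`5` is the only root of `f₁₄` mod `7`). [folklore] -/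
theorem eq_P7_fourteen (hθ : aeval θ (csPoly 14) = 0) (h3 : finrank ℚ K = 3)
    {P : Ideal (𝓞 K)} (hP : P ∈ primesOver (span {((7 : ℕ) : ℤ)}) (𝓞 K))
    (hle : 7 ^ P.inertiaDeg ℤ ≤ 36) :
    P = span {(7 : 𝓞 K), thetaInt hθ - 5} := by
  have h := eq_span_pair_of_unique_root_of_sq hθ h3 csDisc_fourteen_sq (by norm_num) hP hle
    (c₀ := 5) (by decide) (by norm_num)
  simpa using h

/-- `𝔭₁₁ = (11, θ - 7)` (`7` is the only root of `f₁₄` mod `11`). [folklore] -/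
theorem eq_P11_fourteen (hθ : aeval θ (csPoly 14) = 0) (h3 : finrank ℚ K = 3)
    {P : Ideal (𝓞 K)} (hP : P ∈ primesOver (span {((11 : ℕ) : ℤ)}) (𝓞 K))
    (hle : 11 ^ P.inertiaDeg ℤ ≤ 36) :
    P = span {(11 : 𝓞 K), thetaInt hθ - 7} := by
  have h := eq_span_pair_of_unique_root_of_sq hθ h3 csDisc_fourteen_sq (by norm_num) hP hle
    (c₀ := 7) (by decide) (by norm_num)
  simpa using h

/-- `𝔭₁₃ = (13, θ - 11)` (`11` is the only root of `f₁₄` mod `13`). [folklore] -/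
theorem eq_P13_fourteen (hθ : aeval θ (csPoly 14) = 0) (h3 : finrank ℚ K = 3)
    {P : Ideal (𝓞 K)} (hP : P ∈ primesOver (span {((13 : ℕ) : ℤ)}) (𝓞 K))
    (hle : 13 ^ P.inertiaDeg ℤ ≤ 36) :
    P = span {(13 : 𝓞 K), thetaInt hθ - 11} := by
  have h := eq_span_pair_of_unique_root_of_sq hθ h3 csDisc_fourteen_sq (by norm_num) hP hle
    (c₀ := 11) (by decide) (by norm_num)
  simpa using h

/-- `𝔭₁₉ = (19, θ - 12)` (`12` is the only root of `f₁₄` mod `19`). [folklore] -/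
theorem eq_P19_fourteen (hθ : aeval θ (csPoly 14) = 0) (h3 : finrank ℚ K = 3)
    {P : Ideal (𝓞 K)} (hP : P ∈ primesOver (span {((19 : ℕ) : ℤ)}) (𝓞 K))
    (hle : 19 ^ P.inertiaDeg ℤ ≤ 36) :
    P = span {(19 : 𝓞 K), thetaInt hθ - 12} := by
  have h := eq_span_pair_of_unique_root_of_sq hθ h3 csDisc_fourteen_sq (by norm_num) hP hle
    (c₀ := 12) (by decide) (by norm_num)
  simpa using h

/-- `𝔭₂₉ = (29, θ - 28)` (`28` is the only root of `f₁₄` mod `29`). [folklore] -/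
theorem eq_P29_fourteen (hθ : aeval θ (csPoly 14) = 0) (h3 : finrank ℚ K = 3)
    {P : Ideal (𝓞 K)} (hP : P ∈ primesOver (span {((29 : ℕ) : ℤ)}) (𝓞 K))
    (hle : 29 ^ P.inertiaDeg ℤ ≤ 36) :
    P = span {(29 : 𝓞 K), thetaInt hθ - 28} := by
  have h := eq_span_pair_of_unique_root_of_sq hθ h3 csDisc_fourteen_sq (by norm_num) hP hle
    (c₀ := 28) (by decide) (by norm_num)
  simpa using h

/-- `𝔭₃₁ = (31, θ - 27)` (`27` is the only root of `f₁₄` mod `31`). [folklore] -/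
theorem eq_P31_fourteen (hθ : aeval θ (csPoly 14) = 0) (h3 : finrank ℚ K = 3)
    {P : Ideal (𝓞 K)} (hP : P ∈ primesOver (span {((31 : ℕ) : ℤ)}) (𝓞 K))
    (hle : 31 ^ P.inertiaDeg ℤ ≤ 36) :
    P = span {(31 : 𝓞 K), thetaInt hθ - 27} := by
  have h := eq_span_pair_of_unique_root_of_sq hθ h3 csDisc_fourteen_sq (by norm_num) hP hle
    (c₀ := 27) (by decide) (by norm_num)
  simpa using h

/-- `f₁₄ = (x - 9)(x - 11)² + 17 (x² - 18x + 64)`: `17` ramifies, `f₁₄ ≡ (x - 9)(x - 11)² (mod 17)`. [folklore] -/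
theorem csPoly_fourteen_eq_seventeen :
    csPoly 14 = (X - 9) * (X - 11) * (X - 11) + 17 * (X ^ 2 - 18 * X + 64) := by
  simp only [csPoly, map_sub, map_one, map_ofNat]
  ring

/-- `f₁₄ mod 17 = (x - 9)(x - 11)(x - 11)`. [folklore] -/
theorem csPolyMod_fourteen_seventeen :
    csPolyMod 14 17 = (X - C ((9 : ℤ) : ZMod 17)) * (X - C ((11 : ℤ) : ZMod 17)) *
      (X - C ((11 : ℤ) : ZMod 17)) := by
  rw [csPolyMod, csPoly_fourteen_eq_seventeen, Polynomial.map_add]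
  have h17 : Polynomial.map (Int.castRingHom (ZMod 17)) (17 * (X ^ 2 - 18 * X + 64) : ℤ[X]) = 0 := by
    rw [Polynomial.map_mul, show (17 : ℤ[X]) = C 17 from rfl, Polynomial.map_C]
    have : (Int.castRingHom (ZMod 17)) 17 = 0 := by decide
    rw [this, C_0, zero_mul]
  rw [h17, add_zero]
  simp only [Polynomial.map_mul, Polynomial.map_sub, map_X, Polynomial.map_ofNat, Int.cast_ofNat,
    map_ofNat]

/-- **The primes above `17`**: `𝔭₁₇ = (17, θ - 9)` and `𝔭₁₇' = (17, θ - 11)` (the latter ramified). [folklore] -/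
theorem eq_P17_fourteen (hθ : aeval θ (csPoly 14) = 0) (h3 : finrank ℚ K = 3)
    {P : Ideal (𝓞 K)} (hP : P ∈ primesOver (span {((17 : ℕ) : ℤ)}) (𝓞 K)) :
    P = span {(17 : 𝓞 K), thetaInt hθ - 9} ∨ P = span {(17 : 𝓞 K), thetaInt hθ - 11} := by
  rcases eq_span_pair_of_split_of_sq hθ h3 csDisc_fourteen_sq (by norm_num)
    csPolyMod_fourteen_seventeen hP with h | h | h
  · left; simpa using h
  · right; simpa using h
  · right; simpa using h

/-- `f₁₄ = (x - 2)(x - 5)(x - 7) + 23 (3 - 2x)`: `23` splits completely. [folklore] -/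
theorem csPoly_fourteen_eq_twentythree :
    csPoly 14 = (X - 2) * (X - 5) * (X - 7) + 23 * (3 - 2 * X) := by
  simp only [csPoly, map_sub, map_one, map_ofNat]
  ring

/-- `f₁₄ mod 23 = (x - 2)(x - 5)(x - 7)`. [folklore] -/
theorem csPolyMod_fourteen_twentythree :
    csPolyMod 14 23 = (X - C ((2 : ℤ) : ZMod 23)) * (X - C ((5 : ℤ) : ZMod 23)) *
      (X - C ((7 : ℤ) : ZMod 23)) := by
  rw [csPolyMod, csPoly_fourteen_eq_twentythree, Polynomial.map_add]
  have h23 : Polynomial.map (Int.castRingHom (ZMod 23)) (23 * (3 - 2 * X) : ℤ[X]) = 0 := by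
    rw [Polynomial.map_mul, show (23 : ℤ[X]) = C 23 from rfl, Polynomial.map_C]
    have : (Int.castRingHom (ZMod 23)) 23 = 0 := by decide
    rw [this, C_0, zero_mul]
  rw [h23, add_zero]
  simp only [Polynomial.map_mul, Polynomial.map_sub, map_X, Polynomial.map_ofNat, Int.cast_ofNat,
    map_ofNat]

/-- **The primes above `23`**: `(23, θ - 2)`, `(23, θ - 5)`, `(23, θ - 7)`. [folklore] -/
theorem eq_P23_fourteen (hθ : aeval θ (csPoly 14) = 0) (h3 : finrank ℚ K = 3)
    {P : Ideal (𝓞 K)} (hP : P ∈ primesOver (span {((23 : ℕ) : ℤ)}) (𝓞 K)) :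
    P = span {(23 : 𝓞 K), thetaInt hθ - 2} ∨ P = span {(23 : 𝓞 K), thetaInt hθ - 5} ∨
      P = span {(23 : 𝓞 K), thetaInt hθ - 7} := by
  rcases eq_span_pair_of_split_of_sq hθ h3 csDisc_fourteen_sq (by norm_num)
    csPolyMod_fourteen_twentythree hP with h | h | h
  · left; simpa using h
  · right; left; simpa using h
  · right; right; simpa using h


/-! ### Relations among the small primes: explicit generators -/

/-- **`𝔭₇² = (3θ - 1)`** (`N(3θ - 1) = -49`): `3θ - 1 = -3·49 - 7·7(θ - 5) + (θ - 4)(θ - 5)²`. In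
particular `[𝔭₇]² = 1`. [folklore] -/
theorem P7_mul_P7_fourteen (hθ : aeval θ (csPoly 14) = 0) :
    span {(7 : 𝓞 K), thetaInt hθ - 5} * span {(7 : 𝓞 K), thetaInt hθ - 5} =
      span {3 * thetaInt hθ - 1} := by
  have rel := thetaInt_rel_fourteen hθ
  set t := thetaInt hθ with ht
  exact span_pair_mul_span_pair_eq_span_singleton
    (δ₁ := -76 + 123 * t - 9 * t ^ 2) (δ₂ := 53 - 82 * t + 6 * t ^ 2)
    (δ₃ := 53 - 82 * t + 6 * t ^ 2) (δ₄ := -37 + 55 * t - 4 * t ^ 2)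
    (u₁ := -3) (u₂ := -7) (u₃ := 0) (u₄ := t - 4)
    (by linear_combination (27 : 𝓞 K) * rel) (by linear_combination (-18 : 𝓞 K) * rel)
    (by linear_combination (-18 : 𝓞 K) * rel) (by linear_combination (12 : 𝓞 K) * rel)
    (by linear_combination (-1 : 𝓞 K) * rel)

/-- **`𝔭₇ 𝔭₁₁ = (2θ - 3)`** (`N = 77`): `2θ - 3 = 77 + 5·7(θ - 7) - 3·11(θ - 5)`. [folklore] -/
theorem P7_mul_P11_fourteen (hθ : aeval θ (csPoly 14) = 0) :
    span {(7 : 𝓞 K), thetaInt hθ - 5} * span {(11 : 𝓞 K), thetaInt hθ - 7} =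
      span {2 * thetaInt hθ - 3} := by
  have rel := thetaInt_rel_fourteen hθ
  set t := thetaInt hθ with ht
  exact span_pair_mul_span_pair_eq_span_singleton
    (δ₁ := -23 - 50 * t + 4 * t ^ 2) (δ₂ := 15 + 25 * t - 2 * t ^ 2)
    (δ₃ := 17 + 25 * t - 2 * t ^ 2) (δ₄ := -11 - 12 * t + t ^ 2)
    (u₁ := 1) (u₂ := 5) (u₃ := -3) (u₄ := 0)
    (by linear_combination (-8 : 𝓞 K) * rel) (by linear_combination (4 : 𝓞 K) * rel)
    (by linear_combination (4 : 𝓞 K) * rel) (by linear_combination (-2 : 𝓞 K) * rel)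
    (by ring)

/-- **`𝔭₇ 𝔭₁₃ = (θ + 2)`** (`N = 91`): `θ + 2 = 91 + 2·7(θ - 11) - 13(θ - 5)`. [folklore] -/
theorem P7_mul_P13_fourteen (hθ : aeval θ (csPoly 14) = 0) :
    span {(7 : 𝓞 K), thetaInt hθ - 5} * span {(13 : 𝓞 K), thetaInt hθ - 11} =
      span {thetaInt hθ + 2} := by
  have rel := thetaInt_rel_fourteen hθ
  set t := thetaInt hθ with ht
  exact span_pair_mul_span_pair_eq_span_singleton
    (δ₁ := 45 - 16 * t + t ^ 2) (δ₂ := -38 + 16 * t - t ^ 2)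
    (δ₃ := -32 + 16 * t - t ^ 2) (δ₄ := 27 - 15 * t + t ^ 2)
    (u₁ := 1) (u₂ := 2) (u₃ := -1) (u₄ := 0)
    (by linear_combination (-1 : 𝓞 K) * rel) (by linear_combination (1 : 𝓞 K) * rel)
    (by linear_combination (1 : 𝓞 K) * rel) (by linear_combination (-1 : 𝓞 K) * rel)
    (by ring)

/-- **`𝔭₇ 𝔭₁₉ = (θ - 12)`** (`N = 133`): `θ - 12 = -3·133 - 8·7(θ - 12) + 3·19(θ - 5)`. [folklore] -/
theorem P7_mul_P19_fourteen (hθ : aeval θ (csPoly 14) = 0) :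
    span {(7 : 𝓞 K), thetaInt hθ - 5} * span {(19 : 𝓞 K), thetaInt hθ - 12} =
      span {thetaInt hθ - 12} := by
  have rel := thetaInt_rel_fourteen hθ
  set t := thetaInt hθ with ht
  exact span_pair_mul_span_pair_eq_span_singleton
    (δ₁ := -11 - 2 * t + t ^ 2) (δ₂ := 7) (δ₃ := 8 - 2 * t + t ^ 2) (δ₄ := t - 5)
    (u₁ := -3) (u₂ := -8) (u₃ := 3) (u₄ := 0)
    (by linear_combination (-1 : 𝓞 K) * rel) (by ring)
    (by linear_combination (-1 : 𝓞 K) * rel) (by ring)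
    (by ring)

/-- **`𝔭₇ (23, θ - 5) = (θ - 5)`** (`N = 161`): `θ - 5 = 10·7(θ - 5) - 3·23(θ - 5)`. [folklore] -/
theorem P7_mul_P23b_fourteen (hθ : aeval θ (csPoly 14) = 0) :
    span {(7 : 𝓞 K), thetaInt hθ - 5} * span {(23 : 𝓞 K), thetaInt hθ - 5} =
      span {thetaInt hθ - 5} := by
  have rel := thetaInt_rel_fourteen hθ
  set t := thetaInt hθ with ht
  exact span_pair_mul_span_pair_eq_span_singleton
    (δ₁ := -32 - 9 * t + t ^ 2) (δ₂ := 7) (δ₃ := 23) (δ₄ := t - 5)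
    (u₁ := 0) (u₂ := 10) (u₃ := -3) (u₄ := 0)
    (by linear_combination (-1 : 𝓞 K) * rel) (by ring) (by ring) (by ring)
    (by ring)

/-- **`𝔭₇ (23, θ - 7) = (θ² - 4θ + 2)`** (`N = -161`):
`θ² - 4θ + 2 = 161 + 11·7(θ - 7) - 3·23(θ - 5) + (θ - 5)(θ - 7)`. [folklore] -/
theorem P7_mul_P23c_fourteen (hθ : aeval θ (csPoly 14) = 0) :
    span {(7 : 𝓞 K), thetaInt hθ - 5} * span {(23 : 𝓞 K), thetaInt hθ - 7} =
      span {(thetaInt hθ) ^ 2 - 4 * thetaInt hθ + 2} := by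
  have rel := thetaInt_rel_fourteen hθ
  set t := thetaInt hθ with ht
  exact span_pair_mul_span_pair_eq_span_singleton
    (δ₁ := 129 - 387 * t + 29 * t ^ 2) (δ₂ := -38 + 107 * t - 8 * t ^ 2)
    (δ₃ := -88 + 241 * t - 18 * t ^ 2) (δ₄ := 26 - 67 * t + 5 * t ^ 2)
    (u₁ := 1) (u₂ := 11) (u₃ := -3) (u₄ := 1)
    (by linear_combination (97 - 29 * t) * rel) (by linear_combination (-27 + 8 * t) * rel)
    (by linear_combination (-61 + 18 * t) * rel) (by linear_combination (17 - 5 * t) * rel)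
    (by ring)

/-- **`𝔭₇ 𝔭₃₁ = (2θ² - 1)`** (`N = -217`):
`2θ² - 1 = -9·217 - 13·7(θ - 27) + 5·31(θ - 5) + 2(θ - 5)(θ - 27)`. [folklore] -/
theorem P7_mul_P31_fourteen (hθ : aeval θ (csPoly 14) = 0) :
    span {(7 : 𝓞 K), thetaInt hθ - 5} * span {(31 : 𝓞 K), thetaInt hθ - 27} =
      span {2 * (thetaInt hθ) ^ 2 - 1} := by
  have rel := thetaInt_rel_fourteen hθ
  set t := thetaInt hθ with ht
  exact span_pair_mul_span_pair_eq_span_singleton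
    (δ₁ := -281 + 724 * t - 54 * t ^ 2) (δ₂ := 243 - 617 * t + 46 * t ^ 2)
    (δ₃ := 193 - 457 * t + 34 * t ^ 2) (δ₄ := -167 + 390 * t - 29 * t ^ 2)
    (u₁ := -9) (u₂ := -13) (u₃ := 5) (u₄ := 2)
    (by linear_combination (64 + 108 * t) * rel) (by linear_combination (-54 - 92 * t) * rel)
    (by linear_combination (-38 - 68 * t) * rel) (by linear_combination (32 + 58 * t) * rel)
    (by ring)

/-- **`𝔭₁₃ 𝔭₁₇' = (θ - 11)`** (`N = 221`, `𝔭₁₇' = (17, θ - 11)`): `θ - 11 = 4·13(θ - 11) - 3·17(θ - 11)`. [folklore] -/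
theorem P13_mul_P17b_fourteen (hθ : aeval θ (csPoly 14) = 0) :
    span {(13 : 𝓞 K), thetaInt hθ - 11} * span {(17 : 𝓞 K), thetaInt hθ - 11} =
      span {thetaInt hθ - 11} := by
  have rel := thetaInt_rel_fourteen hθ
  set t := thetaInt hθ with ht
  exact span_pair_mul_span_pair_eq_span_singleton
    (δ₁ := -20 - 3 * t + t ^ 2) (δ₂ := 13) (δ₃ := 17) (δ₄ := t - 11)
    (u₁ := 0) (u₂ := 4) (u₃ := -3) (u₄ := 0)
    (by linear_combination (-1 : 𝓞 K) * rel) (by ring) (by ring) (by ring)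
    (by ring)

/-- **`(23, θ - 2) = (θ - 2)` is principal** (`N(θ - 2) = 23`): `23 = (θ - 2)(-11 - 12θ + θ²)`. [folklore] -/
theorem P23a_eq_fourteen (hθ : aeval θ (csPoly 14) = 0) :
    span {(23 : 𝓞 K), thetaInt hθ - 2} = span {thetaInt hθ - 2} := by
  have rel := thetaInt_rel_fourteen hθ
  set t := thetaInt hθ with ht
  exact span_pair_eq_span_singleton (u := 0) (v := 1) (δ := -11 - 12 * t + t ^ 2) (ε := 1)
    (by ring) (by linear_combination (-1 : 𝓞 K) * rel) (by ring)

/-- **`𝔭₂₉ = (29, θ - 28) = (θ + 1)` is principal** (`N(θ + 1) = 29`):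
`θ + 1 = 29 + (θ - 28)`, `29 = (θ + 1)(28 - 15θ + θ²)`, `θ - 28 = (θ + 1)(-27 + 15θ - θ²)`. [folklore] -/
theorem P29_eq_fourteen (hθ : aeval θ (csPoly 14) = 0) :
    span {(29 : 𝓞 K), thetaInt hθ - 28} = span {thetaInt hθ + 1} := by
  have rel := thetaInt_rel_fourteen hθ
  set t := thetaInt hθ with ht
  exact span_pair_eq_span_singleton (u := 1) (v := 1) (δ := 28 - 15 * t + t ^ 2)
    (ε := -27 + 15 * t - t ^ 2)
    (by ring) (by linear_combination (-1 : 𝓞 K) * rel) (by linear_combination (1 : 𝓞 K) * rel)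

/-- **`𝔭₁₇ = (17, θ - 9) = (2θ - 1)` is principal** (`N(2θ - 1) = -17`):
`2θ - 1 = 17 + 2(θ - 9)`, `17 = (2θ - 1)(-25 + 54θ - 4θ²)`, `θ - 9 = (2θ - 1)(13 - 27θ + 2θ²)`. [folklore] -/
theorem P17a_eq_fourteen (hθ : aeval θ (csPoly 14) = 0) :
    span {(17 : 𝓞 K), thetaInt hθ - 9} = span {2 * thetaInt hθ - 1} := by
  have rel := thetaInt_rel_fourteen hθ
  set t := thetaInt hθ with ht
  exact span_pair_eq_span_singleton (u := 1) (v := 2) (δ := -25 + 54 * t - 4 * t ^ 2)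
    (ε := 13 - 27 * t + 2 * t ^ 2)
    (by ring) (by linear_combination (8 : 𝓞 K) * rel) (by linear_combination (-4 : 𝓞 K) * rel)

/-! ### Every ideal class is `1` or `[𝔭₇]` -/

/-- `𝔭₇ = (7, θ - 5)` is a nonzero ideal. [folklore] -/
theorem P7_mem_nonZeroDivisors_fourteen (hθ : aeval θ (csPoly 14) = 0) :
    span {(7 : 𝓞 K), thetaInt hθ - 5} ∈ (Ideal (𝓞 K))⁰ := by
  have h := span_pair_natCast_mem_nonZeroDivisors (K := K) (n := 7) (Nat.succ_ne_zero 6)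
    (thetaInt hθ - 5)
  simp only [Nat.cast_ofNat] at h
  exact h

/-- **Every ideal class of the trace `14` field is `1` or `[𝔭₇]`, and `[𝔭₇]² = 1`** (class number
`≤ 2`; Kim–Yamada's Table 2 lists for `n = 14` a single non-trivial representative). Proof:
`d_K = 16609`, `⌊M_K⌋ ≤ 36`; the primes `P` above `p ≤ 36` with `p ^ {f_P} ≤ 36` are `(2), (3)`,
`𝔭₇, 𝔭₁₁, 𝔭₁₃`, the two primes above `17`, `𝔭₁₉`, the three primes above `23`, `𝔭₂₉, 𝔭₃₁` (`5` is
inert), with the relations `𝔭₇² = (3θ - 1)`, `𝔭₇ 𝔭₁₁ = (2θ - 3)`, `𝔭₇ 𝔭₁₃ = (θ + 2)`,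
`𝔭₁₇ = (2θ - 1)`, `𝔭₁₃ 𝔭₁₇' = (θ - 11)`, `𝔭₇ 𝔭₁₉ = (θ - 12)`, `(23, θ - 2) = (θ - 2)`,
`𝔭₇ (23, θ - 5) = (θ - 5)`, `𝔭₇ (23, θ - 7) = (θ² - 4θ + 2)`, `𝔭₂₉ = (θ + 1)`, `𝔭₇ 𝔭₃₁ = (2θ² - 1)`. [cite: KimYamada2023, §6.1 (proof of Thm. B)] -/
theorem classGroup_mem_pair_fourteen (hθ : aeval θ (csPoly 14) = 0) (h3 : finrank ℚ K = 3)
    (C : ClassGroup (𝓞 K)) :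
    C = 1 ∨ C = ClassGroup.mk0 ⟨span {(7 : 𝓞 K), thetaInt hθ - 5}, P7_mem_nonZeroDivisors_fourteen hθ⟩ := by
  classical
  set c7 : ClassGroup (𝓞 K) :=
    ClassGroup.mk0 ⟨span {(7 : 𝓞 K), thetaInt hθ - 5}, P7_mem_nonZeroDivisors_fourteen hθ⟩ with hc7
  have rel := thetaInt_rel_fourteen hθ
  set t := thetaInt hθ with ht
  have hne : ∀ (x y : 𝓞 K) (n : ℕ), x * y = n → n ≠ 0 → x ≠ 0 := by
    rintro x y n hxy hn rfl
    rw [zero_mul] at hxy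
    exact hn (by exact_mod_cast hxy.symm)
  have hne1 : 3 * t - 1 ≠ 0 :=
    hne _ (-76 + 123 * t - 9 * t ^ 2) 49 (by push_cast; linear_combination (-27 : 𝓞 K) * rel)
      (by norm_num)
  have hne2 : 2 * t - 3 ≠ 0 :=
    hne _ (-23 - 50 * t + 4 * t ^ 2) 77 (by push_cast; linear_combination (8 : 𝓞 K) * rel)
      (by norm_num)
  have hne3 : t + 2 ≠ 0 :=
    hne _ (45 - 16 * t + t ^ 2) 91 (by push_cast; linear_combination (1 : 𝓞 K) * rel) (by norm_num)
  have hne4 : t - 12 ≠ 0 :=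
    hne _ (-11 - 2 * t + t ^ 2) 133 (by push_cast; linear_combination (1 : 𝓞 K) * rel)
      (by norm_num)
  have hne5 : t - 5 ≠ 0 :=
    hne _ (-32 - 9 * t + t ^ 2) 161 (by push_cast; linear_combination (1 : 𝓞 K) * rel)
      (by norm_num)
  have hne6 : t ^ 2 - 4 * t + 2 ≠ 0 :=
    hne _ (129 - 387 * t + 29 * t ^ 2) 161
      (by push_cast; linear_combination (-97 + 29 * t) * rel) (by norm_num)
  have hne7 : 2 * t ^ 2 - 1 ≠ 0 :=
    hne _ (-281 + 724 * t - 54 * t ^ 2) 217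
      (by push_cast; linear_combination (-64 - 108 * t) * rel) (by norm_num)
  have hne8 : t - 11 ≠ 0 :=
    hne _ (-20 - 3 * t + t ^ 2) 221 (by push_cast; linear_combination (1 : 𝓞 K) * rel)
      (by norm_num)
  -- `[𝔭₇]² = 1`
  have hsq : c7 * c7 = 1 := by
    have h : c7 = c7⁻¹ :=
      ClassGroup.mk0_eq_mk0_inv_iff.mpr ⟨3 * t - 1, hne1, by simpa using P7_mul_P7_fourteen hθ⟩
    rwa [eq_inv_iff_mul_eq_one] at h
  let H : Subgroup (ClassGroup (𝓞 K)) := Subgroup.zpowers c7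
  have hc7H : c7 ∈ H := Subgroup.mem_zpowers c7
  have hinv : ∀ (P Q : Ideal (𝓞 K)) (hP0 : P ∈ (Ideal (𝓞 K))⁰) (hQ0 : Q ∈ (Ideal (𝓞 K))⁰) (x : 𝓞 K),
      x ≠ 0 → P * Q = span {x} → ClassGroup.mk0 ⟨P, hP0⟩ = (ClassGroup.mk0 ⟨Q, hQ0⟩)⁻¹ := by
    intro P Q hP0 hQ0 x hx hPQ
    exact ClassGroup.mk0_eq_mk0_inv_iff.mpr ⟨x, hx, by simpa using hPQ⟩
  have hprinc : ∀ (P : Ideal (𝓞 K)) (hP0 : P ∈ (Ideal (𝓞 K))⁰) (x : 𝓞 K), P = span {x} →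
      ClassGroup.mk0 ⟨P, hP0⟩ ∈ H := by
    intro P hP0 x hPx
    have : ClassGroup.mk0 ⟨P, hP0⟩ = 1 :=
      (ClassGroup.mk0_eq_one_iff hP0).mpr ⟨⟨x, by rw [hPx, submodule_span_eq]⟩⟩
    rw [this]
    exact H.one_mem
  have hnz : ∀ (n : ℕ) (hn : n ≠ 0) (x : 𝓞 K), span {(n : 𝓞 K), x} ∈ (Ideal (𝓞 K))⁰ :=
    fun n hn x => span_pair_natCast_mem_nonZeroDivisors (K := K) hn x
  have hP7 : span {(7 : 𝓞 K), t - 5} ∈ (Ideal (𝓞 K))⁰ := P7_mem_nonZeroDivisors_fourteen hθ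
  have hP13 : span {(13 : 𝓞 K), t - 11} ∈ (Ideal (𝓞 K))⁰ := by
    have h := hnz 13 (by norm_num) (t - 11)
    simp only [Nat.cast_ofNat] at h
    exact h
  -- the class of a partner `Q` of `𝔭₇`: `𝔭₇ Q = (x)` gives `[Q] = [𝔭₇]⁻¹`
  have hpartner : ∀ (Q : Ideal (𝓞 K)) (hQ0 : Q ∈ (Ideal (𝓞 K))⁰) (x : 𝓞 K), x ≠ 0 →
      span {(7 : 𝓞 K), t - 5} * Q = span {x} → ClassGroup.mk0 ⟨Q, hQ0⟩ ∈ H := by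
    intro Q hQ0 x hx hQ
    rw [hinv Q _ hQ0 hP7 x hx (by rw [mul_comm]; exact hQ)]
    exact H.inv_mem hc7H
  have h13cls : ClassGroup.mk0 ⟨span {(13 : 𝓞 K), t - 11}, hP13⟩ = c7⁻¹ :=
    hinv _ _ hP13 hP7 (t + 2) hne3 (by rw [mul_comm]; exact P7_mul_P13_fourteen hθ)
  -- Minkowski: `⌊M_K⌋ ≤ 36`
  have hd : ((|NumberField.discr K| : ℤ) : ℝ) ≤ (16609 : ℕ) := by
    rw [discr_eq_fourteen hθ h3]
    norm_num
  have hfloor := floor_minkowskiBound_le_cubic h3 hd (s := 128.9) (U := 36) (by norm_num)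
    (by norm_num) (by norm_num)
  have htop : H = ⊤ := by
    refine classGroup_subgroup_eq_top_of_primesOver H hfloor fun p hp hprime P hP0 hP hle => ?_
    have hpU : p ≤ 36 := (Finset.mem_Icc.mp hp).2
    have h1p : 1 ≤ p := (Finset.mem_Icc.mp hp).1
    interval_cases p
    · exact absurd hprime (by decide)
    · exact hprinc P hP0 _ (eq_span_two_fourteen hθ h3 hP)
    · exact hprinc P hP0 _ (eq_span_three_fourteen hθ h3 hP)
    · exact absurd hprime (by decide)
    · exact hprinc P hP0 _ (eq_span_five_fourteen hθ h3 hP)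
    · exact absurd hprime (by decide)
    · have h7 := eq_P7_fourteen hθ h3 hP hle
      subst h7
      exact hc7H
    · exact absurd hprime (by decide)
    · exact absurd hprime (by decide)
    · exact absurd hprime (by decide)
    · have h11 := eq_P11_fourteen hθ h3 hP hle
      subst h11
      exact hpartner _ hP0 (2 * t - 3) hne2 (P7_mul_P11_fourteen hθ)
    · exact absurd hprime (by decide)
    · have h13 := eq_P13_fourteen hθ h3 hP hle
      subst h13
      exact hpartner _ hP0 (t + 2) hne3 (P7_mul_P13_fourteen hθ)
    · exact absurd hprime (by decide)
    · exact absurd hprime (by decide)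
    · exact absurd hprime (by decide)
    · rcases eq_P17_fourteen hθ h3 hP with h17 | h17 <;> subst h17
      · exact hprinc _ hP0 _ (P17a_eq_fourteen hθ)
      · rw [hinv _ _ hP0 hP13 (t - 11) hne8 (by rw [mul_comm]; exact P13_mul_P17b_fourteen hθ),
          h13cls, inv_inv]
        exact hc7H
    · exact absurd hprime (by decide)
    · have h19 := eq_P19_fourteen hθ h3 hP hle
      subst h19
      exact hpartner _ hP0 (t - 12) hne4 (P7_mul_P19_fourteen hθ)
    · exact absurd hprime (by decide)
    · exact absurd hprime (by decide)
    · exact absurd hprime (by decide)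
    · rcases eq_P23_fourteen hθ h3 hP with h23 | h23 | h23 <;> subst h23
      · exact hprinc _ hP0 _ (P23a_eq_fourteen hθ)
      · exact hpartner _ hP0 (t - 5) hne5 (P7_mul_P23b_fourteen hθ)
      · exact hpartner _ hP0 (t ^ 2 - 4 * t + 2) hne6 (P7_mul_P23c_fourteen hθ)
    · exact absurd hprime (by decide)
    · exact absurd hprime (by decide)
    · exact absurd hprime (by decide)
    · exact absurd hprime (by decide)
    · exact absurd hprime (by decide)
    · have h29 := eq_P29_fourteen hθ h3 hP hle
      subst h29
      exact hprinc _ hP0 _ (P29_eq_fourteen hθ)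
    · exact absurd hprime (by decide)
    · have h31 := eq_P31_fourteen hθ h3 hP hle
      subst h31
      exact hpartner _ hP0 (2 * t ^ 2 - 1) hne7 (P7_mul_P31_fourteen hθ)
    · exact absurd hprime (by decide)
    · exact absurd hprime (by decide)
    · exact absurd hprime (by decide)
    · exact absurd hprime (by decide)
    · exact absurd hprime (by decide)
  have hC : C ∈ H := by rw [htop]; exact Subgroup.mem_top C
  obtain ⟨k, rfl⟩ := Subgroup.mem_zpowers_iff.mp hC
  have h2 : c7 ^ (2 : ℤ) = 1 := by rw [zpow_two]; exact hsq
  obtain ⟨j, rfl | rfl⟩ := Int.even_or_odd' k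
  · left
    rw [zpow_mul, h2, one_zpow]
  · right
    rw [zpow_add, zpow_mul, h2, one_zpow, one_mul, zpow_one]

end Field

/-! ### The ideal classes of `ℤ[X]/(f₁₄)` and Gompf's conjecture for the traces `14` and `-9` -/

section Matrices

/-- **The ideal classes of `ℤ[Θ₁₄] = ℤ[X]/(f₁₄)`**: every non-zero ideal is in the class of
`⟨Θ - 1, 1⟩` or of `⟨Θ - 5, 7⟩` (the representatives `(1, 1, 14)`, `(5, 7, 14)` cover
`C(ℤ[Θ₁₄])`). [cite: KimYamada2023, §6.1 (proof of Thm. B)] -/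
theorem ideal_class_adjoinRoot_fourteen (J : Ideal (AdjoinRoot (csPoly 14))) (hJ : J ≠ ⊥) :
    ∃ x y : AdjoinRoot (csPoly 14), x ≠ 0 ∧ y ≠ 0 ∧
      (span {x} * J = span {y} * csIdeal 1 1 14 ∨ span {x} * J = span {y} * csIdeal 5 7 14) := by
  classical
  set θ' := AdjoinRoot.root (csPolyQ 14) with hθ'
  have hθ : aeval θ' (csPoly 14) = 0 := aeval_root_csPoly 14
  have h3 : finrank ℚ (CSField 14) = 3 := finrank_CSField 14
  obtain ⟨e, he⟩ := exists_ringEquiv_adjoinRoot_of_sq hθ h3 csDisc_fourteen_sq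
  set I : Ideal (𝓞 (CSField 14)) := J.map e with hI
  have hIJ : I.map (e.symm : 𝓞 (CSField 14) →+* AdjoinRoot (csPoly 14)) = J := by
    rw [hI]
    exact Ideal.map_of_equiv e (I := J)
  have hI0 : I ≠ ⊥ := by
    intro h0
    apply hJ
    rw [← hIJ, h0, Ideal.map_bot]
  have hImem : I ∈ (Ideal (𝓞 (CSField 14)))⁰ := mem_nonZeroDivisors_iff_ne_zero.mpr hI0
  have hsymm : ∀ x, (e.symm : 𝓞 (CSField 14) →+* AdjoinRoot (csPoly 14)) (e x) = x :=
    fun x => e.symm_apply_apply x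
  have hP7 : (span {(7 : 𝓞 (CSField 14)), thetaInt hθ - 5}).map
      (e.symm : 𝓞 (CSField 14) →+* AdjoinRoot (csPoly 14)) = csIdeal 5 7 14 := by
    rw [Ideal.map_span, Set.image_insert_eq, Set.image_singleton, map_sub, ← he, hsymm, map_ofNat,
      map_ofNat, csIdeal, Set.pair_comm]
    simp
  rcases classGroup_mem_pair_fourteen hθ h3 (ClassGroup.mk0 ⟨I, hImem⟩) with h1 | h7
  · obtain ⟨z, hz⟩ := ((ClassGroup.mk0_eq_one_iff hImem).mp h1).principal
    have hz' : I = span {z} := by rw [hz, submodule_span_eq]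
    have hz0 : z ≠ 0 := by
      rintro rfl
      apply hI0
      rw [hz', Ideal.span_singleton_eq_bot]
    refine ⟨1, (e.symm : 𝓞 (CSField 14) →+* AdjoinRoot (csPoly 14)) z, one_ne_zero,
      (map_ne_zero_iff _ e.symm.injective).mpr hz0, Or.inl ?_⟩
    rw [Ideal.span_singleton_one, Ideal.top_mul, csIdeal_one_one, Ideal.mul_top, ← hIJ, hz',
      Ideal.map_span, Set.image_singleton]
  · obtain ⟨x, y, hx, hy, hxy⟩ := ClassGroup.mk0_eq_mk0_iff.mp h7
    refine ⟨(e.symm : 𝓞 (CSField 14) →+* AdjoinRoot (csPoly 14)) x,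
      (e.symm : 𝓞 (CSField 14) →+* AdjoinRoot (csPoly 14)) y,
      (map_ne_zero_iff _ e.symm.injective).mpr hx, (map_ne_zero_iff _ e.symm.injective).mpr hy,
      Or.inr ?_⟩
    have h := congrArg (Ideal.map (e.symm : 𝓞 (CSField 14) →+* AdjoinRoot (csPoly 14))) hxy
    simp only [Ideal.map_mul, Ideal.map_span, Set.image_singleton] at h
    rw [hIJ] at h
    rw [h, ← hP7, Ideal.map_span]

/-- `7 ∣ f₁₄(5) = -161`: `(5, 7, 14) ∈ 𝒞𝒮`. [cite: KimYamada2023, §6.1 (proof of Thm. B)] -/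
theorem seven_dvd_eval_csPoly_fourteen_five : (7 : ℤ) ∣ (csPoly 14).eval 5 := by
  rw [eval_csPoly]; norm_num

/-- **Every Cappell–Shaneson matrix of trace `14` is similar to `X_{1,1,14} = A₁₂` or to
`X_{5,7,14}`** (Prop. 2.14). [cite: KimYamada2023, §6.1 (proof of Thm. B) and Prop. 2.14] -/
theorem isConj_standardCSMatrix_of_trace_eq_fourteen (A : SL(3, ℤ))
    (hdet : ((A : Matrix (Fin 3) (Fin 3) ℤ) - 1).det = 1)
    (htr : Matrix.trace (A : Matrix (Fin 3) (Fin 3) ℤ) = 14) :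
    IsConj A (standardCSMatrix 1 1 14 (one_dvd _)) ∨
      IsConj A (standardCSMatrix 5 7 14 seven_dvd_eval_csPoly_fourteen_five) := by
  have hcover : ∀ J : Ideal (AdjoinRoot (csPoly 14)), J ≠ ⊥ →
      ∃ (c d : ℤ) (_ : d ∣ (csPoly 14).eval c) (x y : AdjoinRoot (csPoly 14)),
        x ≠ 0 ∧ y ≠ 0 ∧ Ideal.span {x} * J = Ideal.span {y} * csIdeal c d 14 ∧
          ((c = 1 ∧ d = 1) ∨ (c = 5 ∧ d = 7)) := by
    intro J hJ
    obtain ⟨x, y, hx, hy, hxy⟩ := ideal_class_adjoinRoot_fourteen J hJ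
    rcases hxy with h1 | h7
    · exact ⟨1, 1, one_dvd _, x, y, hx, hy, h1, Or.inl ⟨rfl, rfl⟩⟩
    · exact ⟨5, 7, seven_dvd_eval_csPoly_fourteen_five, x, y, hx, hy, h7, Or.inr ⟨rfl, rfl⟩⟩
  obtain ⟨c, d, h, hconj, hcd⟩ := exists_isConj_standardCSMatrix_of_cover _ hcover A hdet htr
  rcases hcd with ⟨rfl, rfl⟩ | ⟨rfl, rfl⟩
  · exact Or.inl hconj
  · exact Or.inr hconj

/-- **Kim–Yamada 2023, Theorem B for the trace `14`, PROVED**: the non-trivial class `(5, 7, 14)`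
moves by one Gompf move to the trace `7 = 14 - 7` ("every non-trivial element of `C(ℤ[Θₙ])` has
minimal representative `(c, d, n)` such that `n ≡ n₀` for some `6 - n ≤ n₀ ≤ n - 1`", §6.1), where
Gompf's conjecture holds (class number one). [cite: KimYamada2023, Thm. B and §6.1] -/
theorem gompfConjectureForTrace_fourteen : GompfConjectureForTrace 14 := by
  intro A hdet htr
  rcases isConj_standardCSMatrix_of_trace_eq_fourteen A hdet htr with h1 | h7
  · exact (GompfEquiv.of_isConj h1).trans (gompfEquiv_standardCSMatrix_one_one 12 (one_dvd _))
  · exact (GompfEquiv.of_isConj h7).trans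
      (gompfEquiv_standardCSMatrix_akbulutKirbyMatrix_of_modEq
        (gompfConjectureForTrace_of_mem_Icc (by norm_num)) seven_dvd_eval_csPoly_fourteen_five
        (show (14 : ℤ) ≡ 7 [ZMOD 7] by decide))

/-- **Theorem B for the trace `-9`** (`= 5 - 14`), by Theorem A. [cite: KimYamada2023, Thm. A and Thm. B] -/
theorem gompfConjectureForTrace_neg_nine : GompfConjectureForTrace (-9) := by
  have h := gompfConjectureForTrace_of_five_sub gompfConjectureForTrace_fourteen
  norm_num at h
  exact h

end Matrices

end Literature.Topology.FourManifolds

end
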